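import Summits.Parity.GeneralizedHardyLittlewood.Theorems.PrimeLevelFamEdgeMomentsBeyondDiagonalDiagRemMoebiusLogPow
import Summits.Parity.GeneralizedHardyLittlewood.Theorems.PrimeLevelFamEdgeMomentsBeyondDiagonalDiagRemP2HyperbolaTools
import Mathlib.NumberTheory.Harmonic.Bounds
import HarnessLib

/-!
# Route `PrimeLevelFamEdge`, crux K_A `MomentsBeyondDiagonal` (stmt-Parity-20007), line «petersson_layers» v4, stub `stub_diag`:
# **the hyperbola product with power-of-log rates, and `U_{ab}(z) = Σ_{de ≤ z} μ(d)μ(e)logᵃd logᵇe/(de) = κ_{ab} + O((1+log z)⁻ᴺ)`**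
# (brick D2 of «D4TAIL»)

Second universal brick of the `t`-deformation route to «D4TAIL» (see `…DiagRemMoebiusLogPow`): Dirichlet's hyperbola method for
the PRODUCT of two convergent sums. Abstractly: if `F(x) = Σ_{d ≤ x} f(d) = α + O((1+log x)^{−N−p_g})`,
`G(x) = Σ_{e ≤ x} g(e) = β + O((1+log x)^{−N−p_f})` and `Σ_{d ≤ x}|f(d)| ≪ (1+log x)^{p_f}`, `Σ_{e ≤ x}|g(e)| ≪ (1+log x)^{p_g}`, then
`Σ_{de ≤ z} f(d)g(e) = αβ + O((1+log z)^{−N})` — at `u = ⌊√z⌋`,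
`Σ_{de ≤ z} fg − αβ = Σ_{d ≤ u} f(d)(G(z/d) − β) + Σ_{e ≤ u} g(e)(F(z/e) − α) − (G(u) − β)(F(u) − α)` and `1 + log z ≤ 4(1 + log m)`
for every `m ≥ u`. Applied to `f = μ logᵃ/id`, `g = μ logᵇ/id` (`…DiagRemMoebiusLogPow.exists_abs_sum_moebius_div_mul_log_pow_sub_le_pow`):

* `one_add_log_le_four_mul` — `1 + log z ≤ 4(1 + log m)` for `m ≥ ⌊√z⌋`, `m ≥ 1`, `z ≥ 1`;
* `sum_Ioc_eq_sum_Icc_sub` — `Σ_{u < d ≤ n} = Σ_{d ≤ n} − Σ_{d ≤ u}`;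
* `abs_hyperbola_sub_mul_le_pow` — **the abstract hyperbola product with rates** (explicit constant);
* `sum_abs_moebius_div_mul_log_pow_le` — `Σ_{d ≤ x} |μ(d)logᵃd/d| ≤ (1 + log x)^{a+1}`;
* `exists_abs_moebius_logPow_hyperbola_sub_le_pow` — **`∀ a b, ∃ κ_{ab}, ∀ N, ∃ K: |U_{ab}(z) − κ_{ab}| ≤ K/(1+log z)ᴺ` (`z ≥ 1`)**,
  `κ_{ab} = c_a c_b` (`κ₀₀ = κ_{a0} = κ_{0b} = 0`: the tree's `MM(z) → 0`; `κ₁₁ = 1`);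
* `exists_abs_moebius_logPow_hyperbola_le` — the uniform bound `|U_{ab}(z)| ≤ B` (all real `z`).

Def-free; theorems only; classical. Helper `--supports stmt-Parity-20007`; closes nothing; K_A, K_B and the Parity summit are NOT
proved; nothing about Landau–Siegel zeros.

## References
* H. L. Montgomery, R. C. Vaughan, *Multiplicative Number Theory I*, CUP 2007, §2.1 (hyperbola method) and §8.1.
  [cite: MontgomeryVaughan2007, §2.1 — derivation (product of two convergent sums)]
* E. Kowalski, P. Michel, J. VanderKam, J. reine angew. Math. 526 (2000), Prop. 5.1 p. 18 (where these sums are consumed).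
  [cite: KowalskiMichelVanderKam2000, Prop. 5.1 — derivation]
-/

noncomputable section

open Real Finset
open scoped ArithmeticFunction.Moebius

namespace Summit.Parity.GeneralizedHardyLittlewood.Theorems.MomentsBeyondDiagonal.DiagCorner

/-! ### Elementary tools -/

/-- For `z ≥ 1` and every natural `m ≥ max(1, ⌊√z⌋)`: `1 + log z ≤ 4(1 + log m)`. [folklore] -/
theorem one_add_log_le_four_mul {z : ℝ} (hz : 1 ≤ z) {m : ℕ} (hm1 : 1 ≤ m) (hum : ⌊Real.sqrt z⌋₊ ≤ m) :
    1 + Real.log z ≤ 4 * (1 + Real.log m) := by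
  have hz0 : 0 < z := by linarith
  set s : ℝ := Real.sqrt z with hs
  have hs0 : 0 ≤ s := Real.sqrt_nonneg _
  have hss : s * s = z := Real.mul_self_sqrt hz0.le
  have hm1' : (1 : ℝ) ≤ m := by exact_mod_cast hm1
  have hsm : s < (m : ℝ) + 1 := by
    have h1 : s < (⌊s⌋₊ : ℝ) + 1 := Nat.lt_floor_add_one s
    have h2 : (⌊s⌋₊ : ℝ) ≤ m := by exact_mod_cast hum
    linarith
  have hs2m : s ≤ 2 * m := by linarith
  have hz4 : z ≤ (2 * m) ^ 2 := by
    rw [← hss]; nlinarith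
  have hlogz : Real.log z ≤ Real.log 4 + 2 * Real.log m := by
    have h := Real.log_le_log hz0 hz4
    rw [show ((2 : ℝ) * m) ^ 2 = 4 * (m : ℝ) ^ 2 by ring, Real.log_mul (by norm_num) (by positivity), Real.log_pow] at h
    simpa using h
  have hl4 : Real.log 4 < 2 := by
    have h : Real.log 4 = 2 * Real.log 2 := by
      rw [show (4 : ℝ) = 2 ^ 2 by norm_num, Real.log_pow]; norm_num
    have := Real.log_two_lt_d9; rw [h]; linarith
  have hlm : 0 ≤ Real.log (m : ℝ) := Real.log_nonneg hm1'
  linarith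

/-- `Σ_{u < d ≤ n} h(d) = Σ_{d ≤ n} h(d) − Σ_{d ≤ u} h(d)` for `u ≤ n`. [folklore] -/
theorem sum_Ioc_eq_sum_Icc_sub (h : ℕ → ℝ) {u n : ℕ} (hun : u ≤ n) :
    ∑ d ∈ Ioc u n, h d = (∑ d ∈ Icc 1 n, h d) - ∑ d ∈ Icc 1 u, h d := by
  have hsplit : Icc 1 n = Icc 1 u ∪ Ioc u n := by
    ext d; simp only [Finset.mem_union, Finset.mem_Icc, Finset.mem_Ioc]; omega
  have hdisj : Disjoint (Icc 1 u) (Ioc u n) := by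
    rw [Finset.disjoint_left]; intro d hd hd'
    simp only [Finset.mem_Icc, Finset.mem_Ioc] at hd hd'; omega
  rw [hsplit, Finset.sum_union hdisj]
  ring

/-! ### The abstract hyperbola product with rates -/

set_option maxHeartbeats 800000 in
/-- **Hyperbola product with power-of-log rates.** If `Σ_{d ≤ x}|f| ≤ B_f(1+log x)^{p_f}`, `Σ_{e ≤ x}|g| ≤ B_g(1+log x)^{p_g}`,
`|Σ_{d ≤ x} f − α| ≤ K_F/(1+log x)^{N+p_g}`, `|Σ_{e ≤ x} g − β| ≤ K_G/(1+log x)^{N+p_f}` (all `x ≥ 1`), then for `z ≥ 1`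
`|Σ_{d ≤ z}Σ_{e ≤ z/d} f(d)g(e) − αβ| ≤ (4^{N+p_f}B_fK_G + 4^{N+p_g}B_gK_F + 4^{2N+p_f+p_g}K_FK_G)/(1+log z)ᴺ`.
[cite: MontgomeryVaughan2007, §2.1 — derivation (product of two convergent sums)] -/
theorem abs_hyperbola_sub_mul_le_pow (f g : ℕ → ℝ) (α β Bf Bg KF KG : ℝ) (pf pg N : ℕ)
    (hBf : 0 ≤ Bf) (hBg : 0 ≤ Bg) (hKF : 0 ≤ KF) (hKG : 0 ≤ KG)
    (hfabs : ∀ x : ℝ, 1 ≤ x → ∑ d ∈ Icc 1 ⌊x⌋₊, |f d| ≤ Bf * (1 + Real.log x) ^ pf)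
    (hgabs : ∀ x : ℝ, 1 ≤ x → ∑ e ∈ Icc 1 ⌊x⌋₊, |g e| ≤ Bg * (1 + Real.log x) ^ pg)
    (hF : ∀ x : ℝ, 1 ≤ x → |(∑ d ∈ Icc 1 ⌊x⌋₊, f d) - α| ≤ KF / (1 + Real.log x) ^ (N + pg))
    (hG : ∀ x : ℝ, 1 ≤ x → |(∑ e ∈ Icc 1 ⌊x⌋₊, g e) - β| ≤ KG / (1 + Real.log x) ^ (N + pf))
    {z : ℝ} (hz : 1 ≤ z) :
    |(∑ d ∈ Icc 1 ⌊z⌋₊, ∑ e ∈ Icc 1 (⌊z⌋₊ / d), f d * g e) - α * β| ≤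
      (4 ^ (N + pf) * Bf * KG + 4 ^ (N + pg) * Bg * KF + 4 ^ (2 * N + pf + pg) * KF * KG) /
        (1 + Real.log z) ^ N := by
  have hz0 : 0 < z := by linarith
  set L : ℝ := 1 + Real.log z with hLdef
  have hLz0 : 0 ≤ Real.log z := Real.log_nonneg hz
  have hL1 : 1 ≤ L := by rw [hLdef]; linarith
  have hL0 : 0 < L := by linarith
  set Z : ℕ := ⌊z⌋₊ with hZdef
  set u : ℕ := ⌊Real.sqrt z⌋₊ with hudef
  have hsz1 : 1 ≤ Real.sqrt z := by rw [show (1 : ℝ) = Real.sqrt 1 by simp]; exact Real.sqrt_le_sqrt hz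
  have hu1 : 1 ≤ u := Nat.le_floor (by simpa using hsz1)
  have husz : (u : ℝ) ≤ Real.sqrt z := Nat.floor_le (by positivity)
  have hZz : (Z : ℝ) ≤ z := Nat.floor_le hz0.le
  have hzZ : z < (Z : ℝ) + 1 := Nat.lt_floor_add_one z
  have huu : u * u ≤ Z := by
    have h1 : ((u : ℝ)) * u ≤ z := by
      calc (u : ℝ) * u ≤ Real.sqrt z * Real.sqrt z := mul_le_mul husz husz (Nat.cast_nonneg u) (Real.sqrt_nonneg z)
        _ = z := Real.mul_self_sqrt hz0.le
    have h2 : ((u * u : ℕ) : ℝ) ≤ z := by push_cast; exact h1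
    exact Nat.le_floor h2
  have hZu : Z < (u + 1) * (u + 1) := by
    have h1 : Real.sqrt z < (u : ℝ) + 1 := Nat.lt_floor_add_one _
    have h2 : z < ((u : ℝ) + 1) * ((u : ℝ) + 1) := by
      calc z = Real.sqrt z * Real.sqrt z := (Real.mul_self_sqrt hz0.le).symm
        _ < ((u : ℝ) + 1) * ((u : ℝ) + 1) :=
            mul_lt_mul'' h1 h1 (Real.sqrt_nonneg z) (Real.sqrt_nonneg z)
    have h3 : (Z : ℝ) < ((u + 1) * (u + 1) : ℕ) := by push_cast; linarith
    exact_mod_cast h3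
  -- abbreviations for the partial sums
  set F : ℕ → ℝ := fun n ↦ ∑ d ∈ Icc 1 n, f d with hFdef
  set G : ℕ → ℝ := fun n ↦ ∑ e ∈ Icc 1 n, g e with hGdef
  -- the rates at a natural argument `m ≥ u`
  have hrate : ∀ m : ℕ, u ≤ m → ∀ q : ℕ, (1 : ℝ) / (1 + Real.log m) ^ (N + q) ≤ 4 ^ (N + q) / L ^ (N + q) := by
    intro m hum q
    have hm1 : 1 ≤ m := hu1.trans hum
    have h4 := one_add_log_le_four_mul hz hm1 hum
    have hm0 : 0 ≤ Real.log (m : ℝ) := Real.log_natCast_nonneg m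
    have hpos : 0 < (1 + Real.log (m : ℝ)) := by linarith
    rw [div_le_div_iff₀ (pow_pos hpos _) (pow_pos hL0 _), one_mul, ← mul_pow]
    exact pow_le_pow_left₀ hL0.le h4 _
  have hGm : ∀ m : ℕ, u ≤ m → |G m - β| ≤ KG * 4 ^ (N + pf) / L ^ (N + pf) := by
    intro m hum
    have hm1 : (1 : ℝ) ≤ m := by exact_mod_cast hu1.trans hum
    have h := hG (m : ℝ) hm1
    rw [Nat.floor_natCast] at h
    calc |G m - β| ≤ KG / (1 + Real.log m) ^ (N + pf) := h
      _ = KG * (1 / (1 + Real.log m) ^ (N + pf)) := by ring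
      _ ≤ KG * (4 ^ (N + pf) / L ^ (N + pf)) := mul_le_mul_of_nonneg_left (hrate m hum pf) hKG
      _ = KG * 4 ^ (N + pf) / L ^ (N + pf) := by ring
  have hFm : ∀ m : ℕ, u ≤ m → |F m - α| ≤ KF * 4 ^ (N + pg) / L ^ (N + pg) := by
    intro m hum
    have hm1 : (1 : ℝ) ≤ m := by exact_mod_cast hu1.trans hum
    have h := hF (m : ℝ) hm1
    rw [Nat.floor_natCast] at h
    calc |F m - α| ≤ KF / (1 + Real.log m) ^ (N + pg) := h
      _ = KF * (1 / (1 + Real.log m) ^ (N + pg)) := by ring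
      _ ≤ KF * (4 ^ (N + pg) / L ^ (N + pg)) := mul_le_mul_of_nonneg_left (hrate m hum pg) hKF
      _ = KF * 4 ^ (N + pg) / L ^ (N + pg) := by ring
  -- the absolute sums up to `u`
  have hu1r : (1 : ℝ) ≤ u := by exact_mod_cast hu1
  have hlogu : 1 + Real.log (u : ℝ) ≤ L := by
    rw [hLdef]
    have hsz : Real.sqrt z ≤ z := by
      have h := Real.sqrt_le_sqrt (show z ≤ z * z by nlinarith)
      rwa [Real.sqrt_mul_self hz0.le] at h
    have : Real.log (u : ℝ) ≤ Real.log z := Real.log_le_log (by positivity) (husz.trans hsz)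
    linarith
  have hlogu0 : 0 ≤ 1 + Real.log (u : ℝ) := by linarith [Real.log_natCast_nonneg u]
  have hSf : ∑ d ∈ Icc 1 u, |f d| ≤ Bf * L ^ pf := by
    have h := hfabs (u : ℝ) hu1r
    rw [Nat.floor_natCast] at h
    exact h.trans (mul_le_mul_of_nonneg_left (pow_le_pow_left₀ hlogu0 hlogu pf) hBf)
  have hSg : ∑ e ∈ Icc 1 u, |g e| ≤ Bg * L ^ pg := by
    have h := hgabs (u : ℝ) hu1r
    rw [Nat.floor_natCast] at h
    exact h.trans (mul_le_mul_of_nonneg_left (pow_le_pow_left₀ hlogu0 hlogu pg) hBg)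
  -- hyperbola identity and the algebraic rearrangement
  have hdiv : ∀ d ∈ Icc 1 u, u ≤ Z / d := by
    intro d hd
    have hd' := Finset.mem_Icc.1 hd
    exact (Nat.le_div_iff_mul_le (by omega)).2 ((Nat.mul_le_mul_left u hd'.2).trans huu)
  have hhyp := sum_hyperbola_asym (fun d e ↦ f d * g e) huu hZu
  have hT1 : ∑ d ∈ Icc 1 u, ∑ e ∈ Icc 1 (Z / d), f d * g e =
      (∑ d ∈ Icc 1 u, f d * (G (Z / d) - β)) + β * F u := by
    rw [hFdef, hGdef]; dsimp only
    rw [Finset.mul_sum, ← Finset.sum_add_distrib]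
    refine Finset.sum_congr rfl fun d _ ↦ ?_
    have hsw : ∑ e ∈ Icc 1 (Z / d), f d * g e = f d * ∑ e ∈ Icc 1 (Z / d), g e := by rw [Finset.mul_sum]
    rw [hsw]; ring
  have hT2 : ∑ e ∈ Icc 1 u, ∑ d ∈ Ioc u (Z / e), f d * g e =
      (∑ e ∈ Icc 1 u, g e * (F (Z / e) - α)) - G u * (F u - α) := by
    rw [hFdef, hGdef]; dsimp only
    rw [Finset.sum_mul, ← Finset.sum_sub_distrib]
    refine Finset.sum_congr rfl fun e he ↦ ?_
    have hsw : ∑ d ∈ Ioc u (Z / e), f d * g e = g e * ∑ d ∈ Ioc u (Z / e), f d := by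
      rw [Finset.mul_sum]; exact Finset.sum_congr rfl fun d _ ↦ by ring
    rw [hsw, sum_Ioc_eq_sum_Icc_sub f (hdiv e he)]
    ring
  have hkey : (∑ d ∈ Icc 1 Z, ∑ e ∈ Icc 1 (Z / d), f d * g e) - α * β =
      (∑ d ∈ Icc 1 u, f d * (G (Z / d) - β)) + (∑ e ∈ Icc 1 u, g e * (F (Z / e) - α)) -
        (G u - β) * (F u - α) := by
    rw [hhyp, hT1, hT2]; ring
  rw [hkey]
  -- the three bounds
  have hLpf : 0 < L ^ (N + pf) := pow_pos hL0 _
  have hLpg : 0 < L ^ (N + pg) := pow_pos hL0 _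
  have hLN : 0 < L ^ N := pow_pos hL0 _
  have b1 : |∑ d ∈ Icc 1 u, f d * (G (Z / d) - β)| ≤ 4 ^ (N + pf) * Bf * KG / L ^ N := by
    calc |∑ d ∈ Icc 1 u, f d * (G (Z / d) - β)| ≤ ∑ d ∈ Icc 1 u, |f d * (G (Z / d) - β)| :=
          Finset.abs_sum_le_sum_abs _ _
      _ ≤ ∑ d ∈ Icc 1 u, |f d| * (KG * 4 ^ (N + pf) / L ^ (N + pf)) := by
          refine Finset.sum_le_sum fun d hd ↦ ?_
          rw [abs_mul]
          exact mul_le_mul_of_nonneg_left (hGm _ (hdiv d hd)) (abs_nonneg _)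
      _ = (∑ d ∈ Icc 1 u, |f d|) * (KG * 4 ^ (N + pf) / L ^ (N + pf)) := by rw [Finset.sum_mul]
      _ ≤ (Bf * L ^ pf) * (KG * 4 ^ (N + pf) / L ^ (N + pf)) :=
          mul_le_mul_of_nonneg_right hSf (by positivity)
      _ = 4 ^ (N + pf) * Bf * KG / L ^ N := by
          rw [pow_add L N pf]; field_simp
  have b2 : |∑ e ∈ Icc 1 u, g e * (F (Z / e) - α)| ≤ 4 ^ (N + pg) * Bg * KF / L ^ N := by
    calc |∑ e ∈ Icc 1 u, g e * (F (Z / e) - α)| ≤ ∑ e ∈ Icc 1 u, |g e * (F (Z / e) - α)| :=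
          Finset.abs_sum_le_sum_abs _ _
      _ ≤ ∑ e ∈ Icc 1 u, |g e| * (KF * 4 ^ (N + pg) / L ^ (N + pg)) := by
          refine Finset.sum_le_sum fun e he ↦ ?_
          rw [abs_mul]
          exact mul_le_mul_of_nonneg_left (hFm _ (hdiv e he)) (abs_nonneg _)
      _ = (∑ e ∈ Icc 1 u, |g e|) * (KF * 4 ^ (N + pg) / L ^ (N + pg)) := by rw [Finset.sum_mul]
      _ ≤ (Bg * L ^ pg) * (KF * 4 ^ (N + pg) / L ^ (N + pg)) :=
          mul_le_mul_of_nonneg_right hSg (by positivity)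
      _ = 4 ^ (N + pg) * Bg * KF / L ^ N := by
          rw [pow_add L N pg]; field_simp
  have b3 : |(G u - β) * (F u - α)| ≤ 4 ^ (2 * N + pf + pg) * KF * KG / L ^ N := by
    rw [abs_mul]
    have h1 := hGm u le_rfl
    have h2 := hFm u le_rfl
    have hprod : |G u - β| * |F u - α| ≤ (KG * 4 ^ (N + pf) / L ^ (N + pf)) * (KF * 4 ^ (N + pg) / L ^ (N + pg)) :=
      mul_le_mul h1 h2 (abs_nonneg _) (by positivity)
    refine hprod.trans ?_
    -- drop the surplus powers of `L ≥ 1`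
    have hLsur : L ^ N ≤ L ^ (N + pf) * L ^ (N + pg) := by
      rw [← pow_add]
      exact pow_le_pow_right₀ hL1 (by omega)
    have h4 : (4 : ℝ) ^ (N + pf) * 4 ^ (N + pg) = 4 ^ (2 * N + pf + pg) := by
      rw [← pow_add]; congr 1; ring
    rw [div_mul_div_comm, show KG * 4 ^ (N + pf) * (KF * 4 ^ (N + pg)) = (4 ^ (N + pf) * 4 ^ (N + pg)) * KF * KG by ring, h4]
    exact div_le_div_of_nonneg_left (by positivity) hLN hLsur
  calc |(∑ d ∈ Icc 1 u, f d * (G (Z / d) - β)) + (∑ e ∈ Icc 1 u, g e * (F (Z / e) - α)) - (G u - β) * (F u - α)|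
      ≤ |∑ d ∈ Icc 1 u, f d * (G (Z / d) - β)| + |∑ e ∈ Icc 1 u, g e * (F (Z / e) - α)| + |(G u - β) * (F u - α)| := by
        have h12 := abs_add_le (∑ d ∈ Icc 1 u, f d * (G (Z / d) - β)) (∑ e ∈ Icc 1 u, g e * (F (Z / e) - α))
        have h := abs_sub ((∑ d ∈ Icc 1 u, f d * (G (Z / d) - β)) + (∑ e ∈ Icc 1 u, g e * (F (Z / e) - α)))
          ((G u - β) * (F u - α))
        linarith
    _ ≤ 4 ^ (N + pf) * Bf * KG / L ^ N + 4 ^ (N + pg) * Bg * KF / L ^ N + 4 ^ (2 * N + pf + pg) * KF * KG / L ^ N :=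
        add_le_add (add_le_add b1 b2) b3
    _ = _ := by rw [hLdef]; ring

/-! ### The Möbius log-power instance -/

/-- `Σ_{d ≤ x} |μ(d)/d · logᵃd| ≤ (1 + log x)^{a+1}` for `x ≥ 1`. [folklore] -/
theorem sum_abs_moebius_div_mul_log_pow_le (a : ℕ) {x : ℝ} (hx : 1 ≤ x) :
    ∑ d ∈ Icc 1 ⌊x⌋₊, |(ArithmeticFunction.moebius d : ℝ) / d * Real.log d ^ a| ≤ (1 + Real.log x) ^ (a + 1) := by
  have hx0 : 0 < x := by linarith
  have hLx : 0 ≤ Real.log x := Real.log_nonneg hx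
  set J : ℕ := ⌊x⌋₊ with hJ
  have hJ1 : 1 ≤ J := Nat.le_floor (by simpa using hx)
  have hJx : (J : ℝ) ≤ x := Nat.floor_le hx0.le
  have hterm : ∀ d ∈ Icc 1 J, |(ArithmeticFunction.moebius d : ℝ) / d * Real.log d ^ a| ≤ Real.log x ^ a * (d : ℝ)⁻¹ := by
    intro d hd
    have hd' := Finset.mem_Icc.1 hd
    have hd0 : (0 : ℝ) < d := by exact_mod_cast hd'.1
    have hd1 : (1 : ℝ) ≤ d := by exact_mod_cast hd'.1
    have hdx : (d : ℝ) ≤ x := le_trans (by exact_mod_cast hd'.2) hJx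
    have hld0 : 0 ≤ Real.log (d : ℝ) := Real.log_nonneg hd1
    have hld : Real.log (d : ℝ) ≤ Real.log x := Real.log_le_log hd0 hdx
    have hμ : |(ArithmeticFunction.moebius d : ℝ)| ≤ 1 := by exact_mod_cast ArithmeticFunction.abs_moebius_le_one
    rw [abs_mul, abs_div, Nat.abs_cast, abs_of_nonneg (pow_nonneg hld0 a)]
    calc |(ArithmeticFunction.moebius d : ℝ)| / d * Real.log d ^ a ≤ 1 / d * Real.log x ^ a := by
          gcongr
      _ = Real.log x ^ a * (d : ℝ)⁻¹ := by ring
  have hharm : ∑ d ∈ Icc 1 J, (d : ℝ)⁻¹ ≤ 1 + Real.log J := by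
    have h := harmonic_le_one_add_log J
    have h2 : ((harmonic J : ℚ) : ℝ) = ∑ d ∈ Icc 1 J, (d : ℝ)⁻¹ := by
      rw [harmonic_eq_sum_Icc]; push_cast; rfl
    rw [h2] at h
    exact h
  have hlogJ : Real.log (J : ℝ) ≤ Real.log x := Real.log_le_log (by exact_mod_cast hJ1) hJx
  calc ∑ d ∈ Icc 1 J, |(ArithmeticFunction.moebius d : ℝ) / d * Real.log d ^ a|
      ≤ ∑ d ∈ Icc 1 J, Real.log x ^ a * (d : ℝ)⁻¹ := Finset.sum_le_sum hterm
    _ = Real.log x ^ a * ∑ d ∈ Icc 1 J, (d : ℝ)⁻¹ := by rw [Finset.mul_sum]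
    _ ≤ Real.log x ^ a * (1 + Real.log x) := by
        refine mul_le_mul_of_nonneg_left (hharm.trans (by linarith)) (pow_nonneg hLx a)
    _ ≤ (1 + Real.log x) ^ a * (1 + Real.log x) := by
        gcongr; linarith
    _ = (1 + Real.log x) ^ (a + 1) := by rw [pow_succ]

/-- **`U_{ab}(z) = Σ_{d ≤ z}Σ_{e ≤ z/d} μ(d)logᵃd/d · μ(e)logᵇe/e = κ_{ab} + O((1 + log z)⁻ᴺ)`**: for all `a b` there is `κ_{ab}`
(`= c_a c_b` of `…DiagRemMoebiusLogPow`) such that for every `N` there is `K ≥ 0` with `|U_{ab}(z) − κ_{ab}| ≤ K/(1+log z)ᴺ` for all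
`z ≥ 1`. [cite: MontgomeryVaughan2007, §2.1 — derivation (product of two convergent sums)] -/
theorem exists_abs_moebius_logPow_hyperbola_sub_le_pow (a b : ℕ) :
    ∃ κ : ℝ, ∀ N : ℕ, ∃ K : ℝ, 0 ≤ K ∧ ∀ z : ℝ, 1 ≤ z →
      |(∑ d ∈ Icc 1 ⌊z⌋₊, ∑ e ∈ Icc 1 (⌊z⌋₊ / d),
          (ArithmeticFunction.moebius d : ℝ) / d * Real.log d ^ a *
            ((ArithmeticFunction.moebius e : ℝ) / e * Real.log e ^ b)) - κ| ≤ K / (1 + Real.log z) ^ N := by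
  obtain ⟨ca, hca⟩ := exists_abs_sum_moebius_div_mul_log_pow_sub_le_pow a
  obtain ⟨cb, hcb⟩ := exists_abs_sum_moebius_div_mul_log_pow_sub_le_pow b
  refine ⟨ca * cb, fun N ↦ ?_⟩
  obtain ⟨KF, hKF0, hKF⟩ := hca (N + (b + 1))
  obtain ⟨KG, hKG0, hKG⟩ := hcb (N + (a + 1))
  refine ⟨4 ^ (N + (a + 1)) * 1 * KG + 4 ^ (N + (b + 1)) * 1 * KF + 4 ^ (2 * N + (a + 1) + (b + 1)) * KF * KG,
    by positivity, fun z hz ↦ ?_⟩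
  have h := abs_hyperbola_sub_mul_le_pow
    (fun d ↦ (ArithmeticFunction.moebius d : ℝ) / d * Real.log d ^ a)
    (fun e ↦ (ArithmeticFunction.moebius e : ℝ) / e * Real.log e ^ b)
    ca cb 1 1 KF KG (a + 1) (b + 1) N zero_le_one zero_le_one hKF0 hKG0
    (fun x hx ↦ by rw [one_mul]; exact sum_abs_moebius_div_mul_log_pow_le a hx)
    (fun x hx ↦ by rw [one_mul]; exact sum_abs_moebius_div_mul_log_pow_le b hx)
    hKF hKG hz
  exact h

/-- **Uniform bound**: for all `a b` there is `B ≥ 0` with `|U_{ab}(z)| ≤ B` for every real `z`. [folklore] -/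
theorem exists_abs_moebius_logPow_hyperbola_le (a b : ℕ) :
    ∃ B : ℝ, 0 ≤ B ∧ ∀ z : ℝ,
      |∑ d ∈ Icc 1 ⌊z⌋₊, ∑ e ∈ Icc 1 (⌊z⌋₊ / d),
          (ArithmeticFunction.moebius d : ℝ) / d * Real.log d ^ a *
            ((ArithmeticFunction.moebius e : ℝ) / e * Real.log e ^ b)| ≤ B := by
  obtain ⟨κ, hκ⟩ := exists_abs_moebius_logPow_hyperbola_sub_le_pow a b
  obtain ⟨K, hK, hKz⟩ := hκ 0
  refine ⟨K + |κ|, by positivity, fun z ↦ ?_⟩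
  rcases lt_or_ge z 1 with hz | hz
  · have : ⌊z⌋₊ = 0 := Nat.floor_eq_zero.mpr hz
    rw [this, show Finset.Icc (1 : ℕ) 0 = ∅ from Finset.Icc_eq_empty (by norm_num), Finset.sum_empty, abs_zero]
    positivity
  · have h1 := hKz z hz
    rw [pow_zero, div_one] at h1
    set S := ∑ d ∈ Icc 1 ⌊z⌋₊, ∑ e ∈ Icc 1 (⌊z⌋₊ / d),
          (ArithmeticFunction.moebius d : ℝ) / d * Real.log d ^ a *
            ((ArithmeticFunction.moebius e : ℝ) / e * Real.log e ^ b) with hS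
    have : |S| ≤ |S - κ| + |κ| := by
      have := abs_add_le (S - κ) κ
      simpa using this
    linarith

end Summit.Parity.GeneralizedHardyLittlewood.Theorems.MomentsBeyondDiagonal.DiagCorner

end
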